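import Summits.AtomisticToContinuum.HydrodynamicLimit.Theorems.AnnealedZeroHorizonMeanFluxClosureDeviatoricStressClosureB
import Summits.AtomisticToContinuum.HydrodynamicLimit.Theorems.LocalSecondLaw.Negative.TimeIntegral
import Summits.AtomisticToContinuum.HydrodynamicLimit.Theorems.CollisionIsometryCLTCollisionalTransferLocalityGibbsTranslation
import HarnessLib

/-!
# Crux `MeanFluxClosure` (stmt-AtomisticToContinuum-9256), line `registered` — stub KS-b
# (deviatoric kinetic-stress closure), part 3: at equilibrium the mean vanishes for every `N`

Support file (`--supports stmt-AtomisticToContinuum-9256`) for the stub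
`stub_deviatoricStressClosure` (KS-b), continuing parts 1–2. For CONSTANT profiles
`a₀ ≡ a > 0`, `u₀ ≡ u`, `θ₀ ≡ θ > 0` (`σ ≤ 1/2`) the stub's functional `D` (VERBATIM) has mean
exactly `0` under the local Gibbs law, for every `N`, flow, window, smooth `φ` and continuous
probability kernel `k ≥ 0` (`stub_deviatoricStressClosure_equilibrium`): time Fubini +
stationarity (`integral_window_flow_eq_const`, via `map_flow_localGibbsLaw_const` through the
jointly measurable modification `flowReg`), translation invariance of the means of shift-covariant
observables (`integral_translate_eq`, via `map_translate_localGibbsMeasure_const`), a spatial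
Fubini, and `∫_{𝕋³} ∂_jφ_i = ∫_{𝕋³} div φ = 0` (`integral_covariantPairing_eq_zero`,
`integral_stressObservable_eq_zero_const`, `integral_idealObservable_eq_zero_const`). So the stub
holds trivially along the equilibrium sequence; its content is the NON-equilibrium isotropy in
mean of the scale-`ℓ` peculiar stress. No definitions. Reference: Spohn (1991), Part I §2.3.
-/

noncomputable section

namespace Summit.AtomisticToContinuum.HydrodynamicLimit.Theorems

open scoped BigOperators ENNReal Topology InnerProductSpace
open MeasureTheory Set Filter
open Literature.Analysis.FluidPDE Literature.Analysis.FunctionSpaces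
open Literature.MathematicalPhysics.KineticTheory

namespace DeviatoricStressClosure

open LocalSecondLawNegative (flowReg flowReg_of_mem measurable_flowReg)
open HemisphereAffineSlaving (measurePreserving_translate map_translate_localGibbsMeasure_const)

/-- **Time Fubini + stationarity at equilibrium.** For the constant-profile local Gibbs law
(`σ ≤ 1/2`, `a, θ > 0`; flow invariant by `map_flow_localGibbsLaw_const`) and a measurable
observable `G` with `|G(w)| ≤ K (N+1)⁻¹Σ_a‖v_a‖²`,
`E ∫_{t₁}^{t₂} G(Φ_s z) ds = (t₂ − t₁) E G` (Fubini over `(z, s)` through the jointly measurable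
modification `flowReg` of the flow, energy conservation for the domination). [folklore] -/
theorem integral_window_flow_eq_const {σ : ℝ} (hσ : σ ≤ 1 / 2) {a θ : ℝ} (ha : 0 < a) (hθ : 0 < θ)
    (u : V3) {N : ℕ} (Φ : HardSphereFlow (Torus.geometry (Fin 3)) (hsDiameter σ N) (N + 1))
    {G : Config (N + 1) (Fin 3) T3 → ℝ} (hGm : Measurable G) {K : ℝ}
    (hGle : ∀ w, |G w| ≤ K * (((N + 1 : ℕ) : ℝ)⁻¹ * ∑ a, ‖(w a).2‖ ^ 2)) {t₁ t₂ : ℝ}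
    (h₁₂ : t₁ ≤ t₂) :
    ∫ z, (∫ s in t₁..t₂, G (Φ.flow s z)) ∂(localGibbsLaw σ (fun _ => a) (fun _ => u) (fun _ => θ) N Φ) =
      (t₂ - t₁) * ∫ z, G z ∂(localGibbsLaw σ (fun _ => a) (fun _ => u) (fun _ => θ) N Φ) := by
  set μ := localGibbsLaw σ (fun _ => a) (fun _ => u) (fun _ => θ) N Φ with hμ
  haveI hprob : IsProbabilityMeasure μ := isProbabilityMeasure_localGibbsLaw continuous_const
    continuous_const continuous_const (fun _ => ha) (fun _ => hθ) hσ N Φ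
  have hgood : ∀ᵐ z ∂μ, z ∈ Φ.good := (ae_mem_good_localGibbsLaw σ _ _ _ N Φ).1
  set c : ℝ := ((N + 1 : ℕ) : ℝ)⁻¹ with hcdef
  have hEint : Integrable (fun z : Config (N + 1) (Fin 3) T3 => c * ∑ a, ‖(z a).2‖ ^ 2) μ :=
    integrable_energy hσ continuous_const continuous_const continuous_const (fun _ => ha)
      (fun _ => hθ) N Φ
  -- the jointly measurable modification of `(z, s) ↦ G (Φ_s z)`
  set H : Config (N + 1) (Fin 3) T3 × ℝ → ℝ := fun p => G (flowReg Φ p) with hH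
  have hHm : Measurable H := hGm.comp (measurable_flowReg Φ)
  have hHle : ∀ p, ‖H p‖ ≤ K * (c * ∑ a, ‖(p.1 a).2‖ ^ 2) := by
    rintro ⟨z, s⟩
    rw [Real.norm_eq_abs, hH]
    dsimp only
    by_cases hz : z ∈ Φ.good
    · rw [flowReg_of_mem Φ hz s]
      have h := hGle (Φ.flow s z)
      rwa [sum_norm_sq_vel_flow Φ hz s] at h
    · have h : flowReg Φ (z, s) = z := by simp [flowReg, hz]
      rw [h]
      exact hGle z
  have hHint : Integrable H (μ.prod (volume.restrict (Ioc t₁ t₂))) :=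
    Integrable.mono' ((hEint.const_mul K).comp_fst _) hHm.aestronglyMeasurable (ae_of_all _ hHle)
  have h1 : (fun z => ∫ s in t₁..t₂, G (Φ.flow s z)) =ᵐ[μ] fun z => ∫ s in Ioc t₁ t₂, H (z, s) := by
    filter_upwards [hgood] with z hz
    rw [intervalIntegral.integral_of_le h₁₂]
    refine integral_congr_ae (ae_of_all _ fun s => ?_)
    simp only [hH, flowReg_of_mem Φ hz]
  have h3 : ∀ s, ∫ z, H (z, s) ∂μ = ∫ z, G z ∂μ := fun s => by
    have hae : (fun z => H (z, s)) =ᵐ[μ] fun z => G (Φ.flow s z) := by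
      filter_upwards [hgood] with z hz
      simp only [hH, flowReg_of_mem Φ hz]
    rw [integral_congr_ae hae]
    exact integral_comp_flow_localGibbsLaw_const σ a θ u N Φ s hGm.aestronglyMeasurable
  rw [integral_congr_ae h1, integral_integral_swap (f := fun z s => H (z, s)) hHint]
  simp_rw [h3]
  rw [setIntegral_const, smul_eq_mul, Real.volume_real_Ioc, max_eq_left (sub_nonneg.2 h₁₂)]

/-- **Translation invariance.** For the constant-profile local Gibbs law and an observable `S` of
(configuration, base point) which is shift covariant, `S(w, x) = S(T_{−x} w, 0)` with
`T_y (x_a, v_a)_a = (x_a + y, v_a)_a`, the mean `E S(·, x)` does not depend on `x`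
(`map_translate_localGibbsMeasure_const`). [folklore] -/
theorem integral_translate_eq {σ a θ : ℝ} (u : V3) {N : ℕ}
    (Φ : HardSphereFlow (Torus.geometry (Fin 3)) (hsDiameter σ N) (N + 1))
    (S : Config (N + 1) (Fin 3) T3 → T3 → ℝ)
    (hcov : ∀ w x, S w x = S (fun i => ((w i).1 + -x, (w i).2)) 0)
    (hSm : Measurable fun w => S w 0) (x : T3) :
    ∫ w, S w x ∂(localGibbsLaw σ (fun _ => a) (fun _ => u) (fun _ => θ) N Φ) =
      ∫ w, S w 0 ∂(localGibbsLaw σ (fun _ => a) (fun _ => u) (fun _ => θ) N Φ) := by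
  set μ := localGibbsLaw σ (fun _ => a) (fun _ => u) (fun _ => θ) N Φ with hμ
  have hmap : μ.map (fun z : Config (N + 1) (Fin 3) T3 => fun i => ((z i).1 + -x, (z i).2)) = μ := by
    rw [hμ, localGibbsLaw_eq]
    exact map_translate_localGibbsMeasure_const σ a θ u N (-x)
  calc ∫ w, S w x ∂μ = ∫ w, S (fun i => ((w i).1 + -x, (w i).2)) 0 ∂μ :=
        integral_congr_ae (ae_of_all _ fun w => hcov w x)
    _ = ∫ w, S w 0 ∂(μ.map fun z : Config (N + 1) (Fin 3) T3 => fun i => ((z i).1 + -x, (z i).2)) := by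
        rw [integral_map (measurePreserving_translate N (-x)).measurable.aemeasurable]
        rw [hmap]
        exact hSm.aestronglyMeasurable
    _ = ∫ w, S w 0 ∂μ := by rw [hmap]

/-- **Spatial Fubini** under the local Gibbs law (`σ ≤ 1/2`, continuous profiles) for a jointly
measurable integrand dominated by the kinetic energy uniformly in the base point. [folklore] -/
theorem integral_integral_swap_of_le {σ : ℝ} (hσ : σ ≤ 1 / 2) {a₀ θ₀ : T3 → ℝ} {u₀ : T3 → V3}
    (ha : Continuous a₀) (hθ : Continuous θ₀) (hu : Continuous u₀) (ha0 : ∀ x, 0 < a₀ x)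
    (hθ0 : ∀ x, 0 < θ₀ x) {N : ℕ}
    (Φ : HardSphereFlow (Torus.geometry (Fin 3)) (hsDiameter σ N) (N + 1))
    (F : Config (N + 1) (Fin 3) T3 → T3 → ℝ)
    (hFm : Measurable fun p : Config (N + 1) (Fin 3) T3 × T3 => F p.1 p.2) {K : ℝ}
    (hFle : ∀ w x, |F w x| ≤ K * (((N + 1 : ℕ) : ℝ)⁻¹ * ∑ a, ‖(w a).2‖ ^ 2)) :
    (∀ x, Integrable (fun w => F w x) (localGibbsLaw σ a₀ u₀ θ₀ N Φ)) ∧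
      (∫ w, (∫ x, F w x) ∂(localGibbsLaw σ a₀ u₀ θ₀ N Φ)) =
        ∫ x, (∫ w, F w x ∂(localGibbsLaw σ a₀ u₀ θ₀ N Φ)) := by
  haveI := isProbabilityMeasure_localGibbsLaw ha hθ hu ha0 hθ0 hσ N Φ
  have hEint := integrable_energy hσ ha hθ hu ha0 hθ0 N Φ
  have hint : Integrable (Function.uncurry F) ((localGibbsLaw σ a₀ u₀ θ₀ N Φ).prod volume) :=
    Integrable.mono' ((hEint.const_mul K).comp_fst volume) hFm.aestronglyMeasurable
      (ae_of_all _ fun p => by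
        rw [Real.norm_eq_abs]
        exact hFle p.1 p.2)
  refine ⟨fun x => ?_, integral_integral_swap hint⟩
  exact Integrable.mono' (hEint.const_mul K)
    (hFm.comp (measurable_id.prodMk measurable_const)).aestronglyMeasurable
    (ae_of_all _ fun w => by
      rw [Real.norm_eq_abs]
      exact hFle w x)

/-- **Covariant pairings with `∇φ` have mean zero at equilibrium.** For the constant-profile local
Gibbs law, jointly measurable shift-covariant observables `A_ij, B` of (configuration, base
point) dominated by the kinetic energy, and a smooth vector field `φ`,
`E ∫_x [Σ_ij A_ij(·, x) ∂_jφ_i(x) + B(·, x) div φ(x)] dx = 0`: after Fubini the means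
`E A_ij(·, x)`, `E B(·, x)` are constants (translation invariance) and `∫_{𝕋³} ∂_jφ_i = 0`,
`∫_{𝕋³} div φ = 0`. [folklore] -/
theorem integral_covariantPairing_eq_zero {σ : ℝ} (hσ : σ ≤ 1 / 2) {a θ : ℝ} (ha : 0 < a)
    (hθ : 0 < θ) (u : V3) {N : ℕ}
    (Φ : HardSphereFlow (Torus.geometry (Fin 3)) (hsDiameter σ N) (N + 1)) {φ : T3 → V3}
    (hφ : Torus.IsSmooth φ) (A : Fin 3 → Fin 3 → Config (N + 1) (Fin 3) T3 → T3 → ℝ)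
    (B : Config (N + 1) (Fin 3) T3 → T3 → ℝ)
    (hAm : ∀ i j, Measurable fun p : Config (N + 1) (Fin 3) T3 × T3 => A i j p.1 p.2)
    (hBm : Measurable fun p : Config (N + 1) (Fin 3) T3 × T3 => B p.1 p.2) {K : ℝ}
    (hAle : ∀ i j w x, |A i j w x| ≤ K * (((N + 1 : ℕ) : ℝ)⁻¹ * ∑ a, ‖(w a).2‖ ^ 2))
    (hBle : ∀ w x, |B w x| ≤ K * (((N + 1 : ℕ) : ℝ)⁻¹ * ∑ a, ‖(w a).2‖ ^ 2))
    (hAcov : ∀ i j w x, A i j w x = A i j (fun l => ((w l).1 + -x, (w l).2)) 0)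
    (hBcov : ∀ w x, B w x = B (fun l => ((w l).1 + -x, (w l).2)) 0) :
    ∫ w, (∫ x, (∑ i, ∑ j, A i j w x * Torus.partialDeriv j (fun y => φ y i) x) +
        B w x * Torus.divergence φ x)
      ∂(localGibbsLaw σ (fun _ => a) (fun _ => u) (fun _ => θ) N Φ) = 0 := by
  set μ := localGibbsLaw σ (fun _ => a) (fun _ => u) (fun _ => θ) N Φ with hμ
  obtain ⟨C, -, hC⟩ := exists_forall_abs_partialDeriv_le hφ
  have hP := StreamingStressCommutator.continuous_partialDeriv_apply hφ
  have hdivc : Continuous (Torus.divergence φ) := hφ.divergence.continuous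
  have hdiv_le : ∀ x, |Torus.divergence φ x| ≤ 3 * C := fun x => by
    unfold Torus.divergence
    calc |∑ i, Torus.partialDeriv i (fun y => φ y i) x|
        ≤ ∑ i, |Torus.partialDeriv i (fun y => φ y i) x| := Finset.abs_sum_le_sum_abs _ _
      _ ≤ ∑ _i : Fin 3, C := Finset.sum_le_sum fun i _ => hC i i x
      _ = 3 * C := by simp
  -- the integrand, jointly measurable and dominated by the kinetic energy
  set F : Config (N + 1) (Fin 3) T3 → T3 → ℝ := fun w x =>
    (∑ i, ∑ j, A i j w x * Torus.partialDeriv j (fun y => φ y i) x) +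
      B w x * Torus.divergence φ x with hF
  have hFm : Measurable fun p : Config (N + 1) (Fin 3) T3 × T3 => F p.1 p.2 := by
    simp only [hF]
    exact (Finset.measurable_sum _ fun i _ => Finset.measurable_sum _ fun j _ =>
      (hAm i j).mul ((hP i j).measurable.comp measurable_snd)).add
        (hBm.mul (hdivc.measurable.comp measurable_snd))
  have hFle : ∀ w x, |F w x| ≤ 12 * K * C * (((N + 1 : ℕ) : ℝ)⁻¹ * ∑ a, ‖(w a).2‖ ^ 2) := by
    intro w x
    simp only [hF]
    refine (abs_add_le _ _).trans ?_
    have hA' : ∀ i j, |A i j w x * Torus.partialDeriv j (fun y => φ y i) x| ≤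
        K * (((N + 1 : ℕ) : ℝ)⁻¹ * ∑ a, ‖(w a).2‖ ^ 2) * C := fun i j => by
      rw [abs_mul]
      exact mul_le_mul (hAle i j w x) (hC i j x) (abs_nonneg _)
        ((abs_nonneg _).trans (hAle i j w x))
    have hB' : |B w x * Torus.divergence φ x| ≤
        K * (((N + 1 : ℕ) : ℝ)⁻¹ * ∑ a, ‖(w a).2‖ ^ 2) * (3 * C) := by
      rw [abs_mul]
      exact mul_le_mul (hBle w x) (hdiv_le x) (abs_nonneg _) ((abs_nonneg _).trans (hBle w x))
    calc |∑ i, ∑ j, A i j w x * Torus.partialDeriv j (fun y => φ y i) x| +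
          |B w x * Torus.divergence φ x|
        ≤ (∑ _i : Fin 3, ∑ _j : Fin 3, K * (((N + 1 : ℕ) : ℝ)⁻¹ * ∑ a, ‖(w a).2‖ ^ 2) * C) +
            K * (((N + 1 : ℕ) : ℝ)⁻¹ * ∑ a, ‖(w a).2‖ ^ 2) * (3 * C) :=
          add_le_add ((Finset.abs_sum_le_sum_abs _ _).trans (Finset.sum_le_sum fun i _ =>
            (Finset.abs_sum_le_sum_abs _ _).trans (Finset.sum_le_sum fun j _ => hA' i j))) hB'
      _ = 12 * K * C * (((N + 1 : ℕ) : ℝ)⁻¹ * ∑ a, ‖(w a).2‖ ^ 2) := by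
          simp only [Finset.sum_const, Finset.card_univ, Fintype.card_fin]
          ring
  obtain ⟨-, hswap⟩ := integral_integral_swap_of_le hσ continuous_const continuous_const
    continuous_const (fun _ => ha) (fun _ => hθ) Φ F hFm hFle
  have hAint : ∀ i j x, Integrable (fun w => A i j w x) μ := fun i j =>
    (integral_integral_swap_of_le hσ continuous_const continuous_const continuous_const
      (fun _ => ha) (fun _ => hθ) Φ (A i j) (hAm i j) (hAle i j)).1
  have hBint : ∀ x, Integrable (fun w => B w x) μ :=
    (integral_integral_swap_of_le hσ continuous_const continuous_const continuous_const
      (fun _ => ha) (fun _ => hθ) Φ B hBm hBle).1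
  -- translation invariance: the means at base point `x` are the means at `0`
  have hAx : ∀ i j x, ∫ w, A i j w x ∂μ = ∫ w, A i j w 0 ∂μ := fun i j x =>
    integral_translate_eq u Φ (A i j) (hAcov i j)
      ((hAm i j).comp (measurable_id.prodMk measurable_const)) x
  have hBx : ∀ x, ∫ w, B w x ∂μ = ∫ w, B w 0 ∂μ := fun x =>
    integral_translate_eq u Φ B hBcov (hBm.comp (measurable_id.prodMk measurable_const)) x
  have hinner : ∀ x, ∫ w, F w x ∂μ =
      (∑ i, ∑ j, (∫ w, A i j w 0 ∂μ) * Torus.partialDeriv j (fun y => φ y i) x) +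
        (∫ w, B w 0 ∂μ) * Torus.divergence φ x := by
    intro x
    simp only [hF]
    have hSint : ∀ i, Integrable (fun w => ∑ j, A i j w x *
        Torus.partialDeriv j (fun y => φ y i) x) μ :=
      fun i => integrable_finsetSum _ fun j _ => (hAint i j x).mul_const _
    rw [integral_add (integrable_finsetSum _ fun i _ => hSint i) ((hBint x).mul_const _),
      integral_mul_const, hBx x, integral_finsetSum _ fun i _ => hSint i]
    congr 1
    refine Finset.sum_congr rfl fun i _ => ?_
    rw [integral_finsetSum _ fun j _ => (hAint i j x).mul_const _]
    refine Finset.sum_congr rfl fun j _ => ?_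
    rw [integral_mul_const, hAx i j x]
  change ∫ w, (∫ x, F w x) ∂μ = 0
  rw [hswap, ← hμ]
  simp_rw [hinner]
  -- `∫ ∂_jφ_i = 0`, `∫ div φ = 0`
  have hIij : ∀ i j, Integrable (fun x => (∫ w, A i j w 0 ∂μ) *
      Torus.partialDeriv j (fun y => φ y i) x) volume :=
    fun i j => (integrable_of_continuous_T3 (hP i j)).const_mul _
  rw [integral_add (integrable_finsetSum _ fun i _ => integrable_finsetSum _ fun j _ => hIij i j)
    ((integrable_of_continuous_T3 hdivc).const_mul _),
    integral_finsetSum _ fun i _ => integrable_finsetSum _ fun j _ => hIij i j,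
    integral_const_mul, Torus.integral_divergence_eq_zero_holds hφ, mul_zero, add_zero]
  refine Finset.sum_eq_zero fun i _ => ?_
  rw [integral_finsetSum _ fun j _ => hIij i j]
  refine Finset.sum_eq_zero fun j _ => ?_
  rw [integral_const_mul, Torus.integral_partialDeriv_eq_zero_holds (hφ.apply i) j, mul_zero]

/-- **The mollified kinetic stress observable has mean zero at equilibrium**:
`E ∫_x (N+1)⁻¹Σ_a k(x−x_a) Σ_ij v_a^iv_a^j ∂_jφ_i(x) dx = 0` (covariant pairing with `∇φ`,
`A_ij = (N+1)⁻¹Σ_a k(x−x_a) v_a^iv_a^j`, `B = 0`). [folklore] -/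
theorem integral_stressObservable_eq_zero_const {σ : ℝ} (hσ : σ ≤ 1 / 2) {a θ : ℝ} (ha : 0 < a)
    (hθ : 0 < θ) (u : V3) {N : ℕ}
    (Φ : HardSphereFlow (Torus.geometry (Fin 3)) (hsDiameter σ N) (N + 1)) {φ : T3 → V3}
    (hφ : Torus.IsSmooth φ) {k : T3 → ℝ} (hkc : Continuous k) :
    ∫ w, (∫ x, ((N + 1 : ℕ) : ℝ)⁻¹ * ∑ a, k (x - (w a).1) *
        (∑ i, ∑ j, (w a).2 i * (w a).2 j * Torus.partialDeriv j (fun y => φ y i) x))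
      ∂(localGibbsLaw σ (fun _ => a) (fun _ => u) (fun _ => θ) N Φ) = 0 := by
  obtain ⟨Kk, -, hKk⟩ := exists_forall_abs_le_of_continuous hkc
  haveI : OpensMeasurableSpace (Config (N + 1) (Fin 3) T3 × T3) := Prod.opensMeasurableSpace
  set c : ℝ := ((N + 1 : ℕ) : ℝ)⁻¹ with hc
  have hc0 : 0 ≤ c := inv_nonneg.2 (Nat.cast_nonneg _)
  have h := integral_covariantPairing_eq_zero hσ ha hθ u Φ hφ
    (fun i j w x => c * ∑ a, k (x - (w a).1) * ((w a).2 i * (w a).2 j)) (fun _ _ => 0)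
    (fun i j => Continuous.measurable (by fun_prop)) measurable_const (K := Kk)
    (fun i j w x => by
      rw [abs_mul, abs_of_nonneg hc0, mul_left_comm]
      refine mul_le_mul_of_nonneg_left ?_ hc0
      rw [Finset.mul_sum]
      refine (Finset.abs_sum_le_sum_abs _ _).trans (Finset.sum_le_sum fun a _ => ?_)
      rw [abs_mul, abs_mul, sq]
      have hvi : ∀ l, |(w a).2 l| ≤ ‖(w a).2‖ := fun l =>
        (Real.norm_eq_abs _).symm.trans_le (PiLp.norm_apply_le _ l)
      exact mul_le_mul (hKk _) (mul_le_mul (hvi i) (hvi j)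
        (abs_nonneg _) (norm_nonneg _)) (mul_nonneg (abs_nonneg _) (abs_nonneg _))
        ((abs_nonneg (k 0)).trans (hKk 0)))
    (fun w x => by
      rw [abs_zero]
      exact mul_nonneg ((abs_nonneg _).trans (hKk 0))
        (mul_nonneg hc0 (Finset.sum_nonneg fun a _ => sq_nonneg _)))
    (fun i j w x => by
      dsimp only
      congr 1
      exact Finset.sum_congr rfl fun a _ => by rw [show (0 : T3) - ((w a).1 + -x) = x - (w a).1 by abel])
    (fun w x => rfl)
  refine Eq.trans (integral_congr_ae (ae_of_all _ fun w => integral_congr_ae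
    (ae_of_all _ fun x => ?_))) h
  dsimp only
  rw [zero_mul, add_zero]
  simp only [Finset.mul_sum, Finset.sum_mul]
  rw [Finset.sum_comm]
  refine Finset.sum_congr rfl fun i _ => ?_
  rw [Finset.sum_comm]
  exact Finset.sum_congr rfl fun j _ => Finset.sum_congr rfl fun a _ => by ring

/-- **The ideal-stress observable has mean zero at equilibrium**:
`E ∫_x [Σ_ij (Mv_iMv_j/R)∂_jφ_i + RΘ div φ] dx = 0` (covariant pairing with `∇φ`: the
mollified fields are shift covariant, `fields_translate`; domination by the energy,
`abs_reynolds_le_and_abs_pressure_le`, `energyField_le`). [folklore] -/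
theorem integral_idealObservable_eq_zero_const {σ : ℝ} (hσ : σ ≤ 1 / 2) {a θ : ℝ} (ha : 0 < a)
    (hθ : 0 < θ) (u : V3) {N : ℕ}
    (Φ : HardSphereFlow (Torus.geometry (Fin 3)) (hsDiameter σ N) (N + 1)) {φ : T3 → V3}
    (hφ : Torus.IsSmooth φ) {k : T3 → ℝ} (hkc : Continuous k) (hk0 : ∀ y, 0 ≤ k y) :
    ∫ w, (∫ x, (let R : ℝ := empiricalDensityField w (fun y => k (x - y))
        let Mv : V3 := empiricalMomentumField w (fun y => k (x - y))
        let En : ℝ := empiricalEnergyField w (fun y => k (x - y))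
        let Θ : ℝ := 2 / 3 * (En / R - ‖Mv‖ ^ 2 / (2 * R ^ 2))
        (∑ i, ∑ j, (Mv i * Mv j / R) * Torus.partialDeriv j (fun y => φ y i) x) +
          R * Θ * Torus.divergence φ x))
      ∂(localGibbsLaw σ (fun _ => a) (fun _ => u) (fun _ => θ) N Φ) = 0 := by
  obtain ⟨Kk, hKk0, hKk⟩ := exists_forall_abs_le_of_continuous hkc
  haveI : OpensMeasurableSpace (Config (N + 1) (Fin 3) T3 × T3) := Prod.opensMeasurableSpace
  have mR := (continuous_density_prod (n := N + 1) hkc).measurable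
  have hMv := continuous_momentum_prod (n := N + 1) hkc
  have mMv : ∀ l, Measurable fun p : Config (N + 1) (Fin 3) T3 × T3 =>
      empiricalMomentumField p.1 (fun y => k (p.2 - y)) l :=
    fun l => ((PiLp.continuous_apply 2 _ l).comp hMv).measurable
  have mN := (continuous_norm.comp hMv).measurable
  have mEn := (continuous_energy_prod (n := N + 1) hkc).measurable
  have hE : ∀ (w : Config (N + 1) (Fin 3) T3) (x : T3),
      2 * empiricalEnergyField w (fun y => k (x - y)) ≤
        Kk * (((N + 1 : ℕ) : ℝ)⁻¹ * ∑ a, ‖(w a).2‖ ^ 2) := fun w x => by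
    have h := energyField_le w x hKk
    linarith
  dsimp only
  refine integral_covariantPairing_eq_zero hσ ha hθ u Φ hφ
    (fun i j w x => empiricalMomentumField w (fun y => k (x - y)) i *
      empiricalMomentumField w (fun y => k (x - y)) j / empiricalDensityField w (fun y => k (x - y)))
    (fun w x => empiricalDensityField w (fun y => k (x - y)) *
      (2 / 3 * (empiricalEnergyField w (fun y => k (x - y)) /
        empiricalDensityField w (fun y => k (x - y)) -
        ‖empiricalMomentumField w (fun y => k (x - y))‖ ^ 2 /
          (2 * empiricalDensityField w (fun y => k (x - y)) ^ 2))))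
    (fun i j => ((mMv i).mul (mMv j)).div mR)
    (mR.mul (measurable_const.mul ((mEn.div mR).sub ((mN.pow_const 2).div
      (measurable_const.mul (mR.pow_const 2)))))) (K := Kk)
    (fun i j w x => ((abs_reynolds_le_and_abs_pressure_le w x hk0 rfl rfl rfl).2.2.1 i j).trans
      (hE w x))
    (fun w x => (abs_reynolds_le_and_abs_pressure_le w x hk0 rfl rfl rfl).2.2.2.trans ?_)
    (fun i j w x => ?_) (fun w x => ?_)
  · have h0 := (abs_reynolds_le_and_abs_pressure_le w x hk0 rfl rfl rfl).2.1
    have h := hE w x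
    linarith
  · obtain ⟨h1, h2, -⟩ := fields_translate w x k
    rw [h1, h2]
  · obtain ⟨h1, h2, h3⟩ := fields_translate w x k
    rw [h1, h2, h3]

end DeviatoricStressClosure

open DeviatoricStressClosure in
/-- **Registered sub-goal `stub_deviatoricStressClosure_equilibrium` of stub KS-b: at equilibrium
the stub's functional has mean exactly zero, for every `N`.** For
CONSTANT profiles `a₀ ≡ a > 0`, `u₀ ≡ u`, `θ₀ ≡ θ > 0` and `σ ≤ 1/2`, every hard-sphere flow,
every window `t₁ ≤ t₂`, every smooth `φ` and every continuous probability kernel `k ≥ 0`, the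
stub's functional `D` (as in `stub_deviatoricStressClosure` with `Φ` for `Φ N`, `let`s written out)
satisfies `∫ D ∂(localGibbsLaw σ a u θ N Φ) = 0`: by time Fubini and flow invariance
(`integral_window_flow_eq_const`) `E D = (t₂ − t₁)(E T − E J)`, and both the mollified kinetic
stress observable `T` and the ideal-stress observable `J` have mean zero by translation
invariance and `∫_{𝕋³} ∂_jφ_i = ∫_{𝕋³} div φ = 0`. [folklore] -/
theorem stub_deviatoricStressClosure_equilibrium : ∀ (σ : ℝ), σ ≤ 1 / 2 → ∀ (a θ : ℝ), 0 < a → 0 < θ → ∀ (u : Literature.MathematicalPhysics.KineticTheory.V3) (N : ℕ) (Φ : Literature.Analysis.FluidPDE.HardSphereFlow (Literature.Analysis.FluidPDE.Torus.geometry (Fin 3)) (Literature.MathematicalPhysics.KineticTheory.hsDiameter σ N) (N + 1)) (t₁ t₂ : ℝ), t₁ ≤ t₂ → ∀ (φ : Literature.MathematicalPhysics.KineticTheory.T3 → Literature.MathematicalPhysics.KineticTheory.V3), Literature.Analysis.FunctionSpaces.Torus.IsSmooth φ → ∀ (k : Literature.MathematicalPhysics.KineticTheory.T3 → ℝ), Continuous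 k → (∀ y, 0 ≤ k y) → (∫ y, k y = 1) → ∀ D : Literature.Analysis.FluidPDE.Config (N + 1) (Fin 3) Literature.MathematicalPhysics.KineticTheory.T3 → ℝ, D = (fun z => (∫ s in t₁..t₂, ∫ x, ((N + 1 : ℕ) : ℝ)⁻¹ * ∑ a, k (x - (Φ.flow s z a).1) * (∑ i, ∑ j, (Φ.flow s z a).2 i * (Φ.flow s z a).2 j * Literature.Analysis.FunctionSpaces.Torus.partialDeriv j (fun y => φ y i) x)) - (∫ s in t₁..t₂, ∫ x, ((∑ i, ∑ j, (Literature.MathematicalPhysics.KineticTheory.empiricalMomentumField (Φ.flow s z) (fun y => k (x - y)) i * Literature.MathematicalPhysics.KineticTheory.empiricalMomentumField (Φ.flow s z) (fun y => k (x - y)) j / Literature.MathematicalPhysics.KineticTheory.empiricalDensityField (Φ.flow s z) (fun y => k (x - y))) * Literature.Analysis.FunctionSpaces.Torus.partialDeriv j (fun y => φ y i) x) + Literature.MathematicalPhysics.KineticTheory.empiricalDensityField (Φ.flow s z) (fun y => k (x - y)) * (2 / 3 * (Literature.MathematicalPhysics.KineticTheory.empiricalEnergyField (Φ.flow s z) (fun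 y => k (x - y)) / Literature.MathematicalPhysics.KineticTheory.empiricalDensityField (Φ.flow s z) (fun y => k (x - y)) - ‖Literature.MathematicalPhysics.KineticTheory.empiricalMomentumField (Φ.flow s z) (fun y => k (x - y))‖ ^ 2 / (2 * Literature.MathematicalPhysics.KineticTheory.empiricalDensityField (Φ.flow s z) (fun y => k (x - y)) ^ 2))) * Literature.Analysis.FunctionSpaces.Torus.divergence φ x))) → ∫ z, D z ∂Literature.MathematicalPhysics.KineticTheory.localGibbsLaw σ (fun _ => a) (fun _ => u) (fun _ => θ) N Φ = 0 := by
  intro σ hσ a θ ha hθ u N Φ t₁ t₂ h₁₂ φ hφ k hkc hk0 hk1 D hD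
  set μ := localGibbsLaw σ (fun _ => a) (fun _ => u) (fun _ => θ) N Φ with hμ
  obtain ⟨C, -, hC⟩ := exists_forall_abs_partialDeriv_le hφ
  set c : ℝ := ((N + 1 : ℕ) : ℝ)⁻¹ with hc
  have hc0 : 0 ≤ c := inv_nonneg.2 (Nat.cast_nonneg _)
  -- the two observables
  set T : Config (N + 1) (Fin 3) T3 → ℝ := fun w => ∫ x, c * ∑ a, k (x - (w a).1) *
    (∑ i, ∑ j, (w a).2 i * (w a).2 j * Torus.partialDeriv j (fun y => φ y i) x) with hT
  set J : Config (N + 1) (Fin 3) T3 → ℝ := fun w => ∫ x,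
    (let R : ℝ := empiricalDensityField w (fun y => k (x - y))
    let Mv : V3 := empiricalMomentumField w (fun y => k (x - y))
    let En : ℝ := empiricalEnergyField w (fun y => k (x - y))
    let Θ : ℝ := 2 / 3 * (En / R - ‖Mv‖ ^ 2 / (2 * R ^ 2))
    (∑ i, ∑ j, (Mv i * Mv j / R) * Torus.partialDeriv j (fun y => φ y i) x) +
      R * Θ * Torus.divergence φ x) with hJ
  have hTm : Measurable T := (StreamingStressCommutator.continuous_mollifiedStress hφ hkc c).measurable
  have hJm : Measurable J := measurable_idealObservable hkc hφ
  have hTle : ∀ w, |T w| ≤ 9 * C * (c * ∑ a, ‖(w a).2‖ ^ 2) := fun w =>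
    abs_integral_stressIntegrand_le w hkc hk0 hk1 hC hc0
  have hJle : ∀ w, |J w| ≤ 10 * C * (c * ∑ a, ‖(w a).2‖ ^ 2) := fun w =>
    abs_integral_idealIntegrand_le w hkc hk0 hk1 hC
  have hWTi : Integrable (fun z => ∫ s in t₁..t₂, T (Φ.flow s z)) μ :=
    integrable_window_flow hσ continuous_const continuous_const continuous_const (fun _ => ha)
      (fun _ => hθ) Φ hTm hTle t₁ t₂
  have hWJi : Integrable (fun z => ∫ s in t₁..t₂, J (Φ.flow s z)) μ :=
    integrable_window_flow hσ continuous_const continuous_const continuous_const (fun _ => ha)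
      (fun _ => hθ) Φ hJm hJle t₁ t₂
  have hD' : D = fun z => (∫ s in t₁..t₂, T (Φ.flow s z)) - ∫ s in t₁..t₂, J (Φ.flow s z) := hD
  rw [hD', integral_sub hWTi hWJi, integral_window_flow_eq_const hσ ha hθ u Φ hTm hTle h₁₂,
    integral_window_flow_eq_const hσ ha hθ u Φ hJm hJle h₁₂, hT, hJ,
    integral_stressObservable_eq_zero_const hσ ha hθ u Φ hφ hkc,
    integral_idealObservable_eq_zero_const hσ ha hθ u Φ hφ hkc hk0, mul_zero, sub_zero]


end Summit.AtomisticToContinuum.HydrodynamicLimit.Theorems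

end
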